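import Literature.NumberTheory.Automorphic.ArchKirillovFunctionGL2
import Literature.NumberTheory.Automorphic.ArchGardingDensityRiesz
import Mathlib.Analysis.Calculus.ParametricIntegral
import HarnessLib

/-!
# Smoothing Gårding vectors by compactly supported measures on `GL_n(K_∞)`: derivatives and exchange with functionals

Topic `NumberTheory/Automorphic`; namespace `Literature.NumberTheory.Automorphic`. Theorems only (no
named fact). For a strongly continuous representation `τ` of `G_∞ = GL_n(K_∞)` by operators of norm
`≤ 1` (e.g. unitary) on a Banach space `E`, a finite measure `ν` on `G_∞` carried by a compact set, and
a family `h ↦ x_h ∈ 𝒢` which is a finite continuous combination of Gårding vectors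
(`IsGardingContComb`, `ArchKirillovFunctionGL2`), consider the smoothed vector

  `S = ∫ τ(h) x_h dν(h)`.

We PROVE:

* `hasDerivAt_apply_expGL_smul` — Gårding orbits are differentiable at every time:
  `d/dt τ(e^{tX}) v = τ(e^{tX}) τ(X) v`;
* `hasDerivAt_integral_apply_expGL_mul` and `archDerivE_integral_apply_toArch` — **differentiation
  under the smoothing integral**: `τ(X) S = ∫ τ(h) τ(Ad(h⁻¹) X) x_h dν(h)` (conjugate the one-parameter
  group past `h`: `e^{sX} h = h e^{s h⁻¹ X h}`; dominated convergence on the compact carrier); the word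
  version `archWordDerivE_integral_apply_toArch`;
* `apply_integral_apply_toArch_eq_integral` — **exchange with Sobolev-bounded functionals**: for a
  linear functional `ℓ` on `𝒢` bounded by finitely many `U(𝔤)`-seminorms (`E` Hilbert), if `S ∈ 𝒢` then
  `ℓ(S) = ∫ ℓ(τ(h) x_h) dν(h)` — by the Riesz form `ℓ = Σ_w ⟪y_w, τ(w) ·⟫`
  (`ArchGardingDensityRiesz.exists_eq_sum_inner_archWordDerivE`), the word formula and
  `τ(h) τ(Ad(h⁻¹)w) = τ(w) τ(h)`.

These are the "integrated form" manipulations behind Jacquet–Shalika's use of `P`-smooth vectors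
(Jacquet–Shalika (1981), §3, (3.1)–(3.3), proof of (3.16)): smoothing along the unipotent radical and the
torus of the mirabolic subgroup, on the closability route to
`Literature.NumberTheory.Automorphic.JacquetShalika1981_archKirillovNorm_le 1 K`.

## References

* H. Jacquet, J. A. Shalika, *On Euler products and the classification of automorphic
  representations I*, Amer. J. Math. 103 (1981), §3, (3.1)–(3.3) [JacquetShalikaAJM1981].
* G. B. Folland, *A Course in Abstract Harmonic Analysis* (1995), §3.1 (integrated representation)
  [Folland1995].
-/

noncomputable section

open MeasureTheory Measure NumberField NumberField.mixedEmbedding NumberField.InfinitePlace IsDedekindDomain Set Filter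
  Complex
open scoped MatrixGroups ENNReal NNReal Classical Topology ComplexConjugate Real InnerProductSpace

namespace Literature.NumberTheory.Automorphic

variable {K : Type} [Field K] [NumberField K]

attribute [local instance] glInfBorel borelSpace_glInf locallyCompactSpace_glInf secondCountableTopology_glInf

-- as in `ArchGardingWhittaker`
set_option backward.isDefEq.respectTransparency false

variable {n : ℕ} {hcpt : isCompact_glFiniteIntegralLevel n K}

/-! ### 1. Orbits of Gårding vectors are differentiable at every time -/

section Orbit

variable {E : Type*} [NormedAddCommGroup E] [NormedSpace ℂ E] [CompleteSpace E]
  {τ : ContRepresentation ℂ (AutomorphyDatum.gl n K hcpt).arch.carrier E}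

/-- **`d/dt τ(e^{tX}) v |_{t=s} = τ(e^{sX}) τ(X) v`** for a Gårding vector `v`
(`e^{tX} = e^{sX} e^{(t-s)X}` and the derivative at `0`). [folklore] -/
theorem hasDerivAt_apply_expGL_smul (hτ : τ.IsStronglyContinuous) {v : E} (hv : v ∈ archGardingSpace hcpt τ)
    (X : Matrix (Fin n) (Fin n) (mixedSpace K)) (s : ℝ) :
    HasDerivAt (fun t : ℝ => τ (toArch hcpt (expGL (t • X))) v)
      (τ (toArch hcpt (expGL (s • X))) (archDerivE hcpt τ X v)) s := by
  set f : ℝ → E := fun t => τ (toArch hcpt (expGL (t • X))) v with hf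
  set L : E →L[ℂ] E := τ (toArch hcpt (expGL (s • X))) with hL
  have h0 : HasDerivAt f (archDerivE hcpt τ X v) (s - s) := by
    rw [sub_self]; exact hasDerivAt_apply_expGL_of_mem_archGardingSpace hτ hv X
  -- shift the time
  have h1 : HasDerivAt (fun t : ℝ => f (t - s)) (archDerivE hcpt τ X v) s := h0.comp_sub_const s s
  have h2 : HasDerivAt (fun t : ℝ => L (f (t - s))) (L (archDerivE hcpt τ X v)) s :=
    (L.restrictScalars ℝ).hasFDerivAt.comp_hasDerivAt s h1
  refine h2.congr_of_eventuallyEq (Eventually.of_forall fun t => ?_)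
  simp only [hf, hL]
  rw [← ContinuousLinearMap.comp_apply, ← ContinuousLinearMap.mul_def, ← map_mul]
  congr 2
  refine Subtype.ext ?_
  change expGL (t • X) = expGL (s • X) * expGL ((t - s) • X)
  rw [← expGL_add_smul, add_sub_cancel]

/-- `e^{sX} h = h e^{s · h⁻¹ X h}`. [folklore] -/
theorem expGL_smul_mul_eq (h : GL (Fin n) (mixedSpace K)) (X : Matrix (Fin n) (Fin n) (mixedSpace K)) (s : ℝ) :
    expGL (s • X) * h = h * expGL (s • (((h⁻¹ : GL (Fin n) (mixedSpace K)) : Matrix (Fin n) (Fin n) (mixedSpace K)) * X *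
      (h : Matrix (Fin n) (Fin n) (mixedSpace K)))) := by
  have e := expGL_smul_conj h⁻¹ X s
  rw [inv_inv] at e
  rw [e, ← mul_assoc, ← mul_assoc, mul_inv_cancel, one_mul]

end Orbit

/-! ### 2. Differentiation under the smoothing integral -/

section Smoothing

variable {E : Type*} [NormedAddCommGroup E] [NormedSpace ℂ E] [CompleteSpace E]
  {τ : ContRepresentation ℂ (AutomorphyDatum.gl n K hcpt).arch.carrier E}

omit [NumberField K] in
/-- `Ad(h⁻¹) X = h⁻¹ X h` as a function of `h` is continuous. [folklore] -/
theorem continuous_conj_inv (X : Matrix (Fin n) (Fin n) (mixedSpace K)) :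
    Continuous fun h : GL (Fin n) (mixedSpace K) => ((h⁻¹ : GL (Fin n) (mixedSpace K)) : Matrix (Fin n) (Fin n) (mixedSpace K)) * X *
      (h : Matrix (Fin n) (Fin n) (mixedSpace K)) :=
  (Units.continuous_coe_inv.mul continuous_const).mul Units.continuous_val

omit [CompleteSpace E] in
/-- The smoothing integrand `h ↦ τ(g h) x_h` of a finite continuous combination is continuous. [folklore] -/
theorem continuous_apply_toArch_mul_comb (hτ : τ.IsStronglyContinuous) {x : GL (Fin n) (mixedSpace K) → E}
    (hx : IsGardingContComb hcpt τ x) (g : GL (Fin n) (mixedSpace K)) :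
    Continuous fun h : GL (Fin n) (mixedSpace K) => τ (toArch hcpt (g * h)) (x h) := by
  obtain ⟨ι, _, c, e, hc, -, hF⟩ := hx
  have heq : (fun h : GL (Fin n) (mixedSpace K) => τ (toArch hcpt (g * h)) (x h)) =
      fun h => ∑ i, c i h • τ (toArch hcpt (g * h)) (e i) := by
    funext h; rw [hF h, _root_.map_sum]; simp only [map_smul]
  rw [heq]
  exact continuous_finsetSum _ fun i _ => (hc i).smul ((continuous_apply_toArch hcpt τ hτ (e i)).comp (continuous_const.mul continuous_id))

omit [NumberField K] [NormedSpace ℂ E] [CompleteSpace E] in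
/-- A continuous `E`-valued function is bounded on a compact set. [folklore] -/
theorem exists_forall_mem_norm_le {F : GL (Fin n) (mixedSpace K) → E} (hF : Continuous F) {κ : Set (GL (Fin n) (mixedSpace K))}
    (hκ : IsCompact κ) : ∃ M : ℝ, ∀ h ∈ κ, ‖F h‖ ≤ M := by
  obtain ⟨M, hM⟩ := hκ.exists_bound_of_continuousOn hF.continuousOn
  exact ⟨M, hM⟩

/-- **Differentiation under the smoothing integral.** Let `τ` act by operators of norm `≤ 1`, `ν` be a
finite measure on `G_∞` carried by a compact set `κ`, and `x` a finite continuous combination of Gårding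
vectors. Then `s ↦ ∫ τ(e^{sX} h) x_h dν(h)` is differentiable at `0` with derivative
`∫ τ(h) τ(h⁻¹ X h) x_h dν(h)` (`e^{sX} h = h e^{s h⁻¹Xh}`, dominated convergence). [folklore] -/
theorem hasDerivAt_integral_apply_expGL_mul (hτ : τ.IsStronglyContinuous) (hτb : ∀ g, ‖(τ g : E →L[ℂ] E)‖ ≤ 1)
    (ν : Measure (GL (Fin n) (mixedSpace K))) [IsFiniteMeasure ν] {κ : Set (GL (Fin n) (mixedSpace K))} (hκ : IsCompact κ)
    (hνκ : ∀ᵐ h ∂ν, h ∈ κ) {x : GL (Fin n) (mixedSpace K) → E} (hx : IsGardingContComb hcpt τ x)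
    (X : Matrix (Fin n) (Fin n) (mixedSpace K)) :
    HasDerivAt (fun s : ℝ => ∫ h, τ (toArch hcpt (expGL (s • X) * h)) (x h) ∂ν)
      (∫ h, τ (toArch hcpt h) (archDerivE hcpt τ (((h⁻¹ : GL (Fin n) (mixedSpace K)) : Matrix (Fin n) (Fin n) (mixedSpace K)) * X *
        (h : Matrix (Fin n) (Fin n) (mixedSpace K))) (x h)) ∂ν) 0 := by
  set Xh : GL (Fin n) (mixedSpace K) → Matrix (Fin n) (Fin n) (mixedSpace K) :=
    fun h => ((h⁻¹ : GL (Fin n) (mixedSpace K)) : Matrix (Fin n) (Fin n) (mixedSpace K)) * X * (h : Matrix (Fin n) (Fin n) (mixedSpace K)) with hXh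
  set F : ℝ → GL (Fin n) (mixedSpace K) → E := fun s h => τ (toArch hcpt (expGL (s • X) * h)) (x h) with hFdef
  set F' : ℝ → GL (Fin n) (mixedSpace K) → E :=
    fun s h => τ (toArch hcpt h) (τ (toArch hcpt (expGL (s • Xh h))) (archDerivE hcpt τ (Xh h) (x h))) with hF'def
  -- the derivative family is a finite continuous combination, hence bounded on `κ`
  have hD : IsGardingContComb hcpt τ (fun h => archDerivE hcpt τ (Xh h) (x h)) := hx.apply_archDerivE hτ (continuous_conj_inv X)
  obtain ⟨M, hM⟩ := exists_forall_mem_norm_le hD.continuous hκ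
  have hMnn : ∀ h ∈ κ, ∀ s : ℝ, ‖F' s h‖ ≤ M := by
    intro h hh s
    calc ‖F' s h‖ ≤ ‖(τ (toArch hcpt h) : E →L[ℂ] E)‖ * ‖τ (toArch hcpt (expGL (s • Xh h))) (archDerivE hcpt τ (Xh h) (x h))‖ :=
          ContinuousLinearMap.le_opNorm _ _
      _ ≤ 1 * (‖(τ (toArch hcpt (expGL (s • Xh h))) : E →L[ℂ] E)‖ * ‖archDerivE hcpt τ (Xh h) (x h)‖) :=
          mul_le_mul (hτb _) (ContinuousLinearMap.le_opNorm _ _) (norm_nonneg _) zero_le_one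
      _ ≤ 1 * (1 * M) := by
          refine mul_le_mul_of_nonneg_left (mul_le_mul (hτb _) (hM h hh) (norm_nonneg _) zero_le_one) zero_le_one
      _ = M := by ring
  -- pointwise derivative
  have hderiv : ∀ h, ∀ s : ℝ, HasDerivAt (fun s => F s h) (F' s h) s := by
    intro h s
    have h1 := hasDerivAt_apply_expGL_smul hτ (hx.mem h) (Xh h) s
    set L : E →L[ℂ] E := τ (toArch hcpt h) with hL
    have h2 : HasDerivAt (fun t : ℝ => L (τ (toArch hcpt (expGL (t • Xh h))) (x h))) (F' s h) s :=
      (L.restrictScalars ℝ).hasFDerivAt.comp_hasDerivAt s h1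
    refine h2.congr_of_eventuallyEq (Eventually.of_forall fun t => ?_)
    simp only [hFdef, hL]
    rw [← ContinuousLinearMap.comp_apply, ← ContinuousLinearMap.mul_def, ← map_mul]
    congr 2
    exact Subtype.ext (expGL_smul_mul_eq h X t)
  -- measurability and integrability
  have hFc : ∀ s, Continuous (F s) := fun s => continuous_apply_toArch_mul_comb hτ hx (expGL (s • X))
  have hF'c : Continuous (F' 0) := by
    have h' : (F' 0) = fun h => τ (toArch hcpt (1 * h)) (archDerivE hcpt τ (Xh h) (x h)) := by
      funext h
      simp only [hF'def, zero_smul, expGL_zero, one_mul]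
      have : toArch hcpt (1 : GL (Fin n) (mixedSpace K)) = 1 := rfl
      rw [this, map_one]; rfl
    rw [h']
    exact continuous_apply_toArch_mul_comb hτ hD 1
  obtain ⟨M₀, hM₀⟩ := exists_forall_mem_norm_le (hFc 0) hκ
  have hint : Integrable (F 0) ν := by
    refine Integrable.mono' (integrable_const (max M₀ 0)) (hFc 0).aestronglyMeasurable ?_
    filter_upwards [hνκ] with h hh
    exact (hM₀ h hh).trans (le_max_left _ _)
  have key := (hasDerivAt_integral_of_dominated_loc_of_deriv_le (μ := ν) (F := F) (F' := F') (x₀ := (0 : ℝ))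
    (bound := fun _ => M) (Metric.ball_mem_nhds (0 : ℝ) one_pos)
    (Eventually.of_forall fun s => (hFc s).aestronglyMeasurable) hint hF'c.aestronglyMeasurable ?_ (integrable_const M) ?_).2
  · -- identify the derivative
    have hF'0 : (fun h => F' 0 h) = fun h => τ (toArch hcpt h) (archDerivE hcpt τ (Xh h) (x h)) := by
      funext h
      simp only [hF'def, zero_smul, expGL_zero]
      have : toArch hcpt (1 : GL (Fin n) (mixedSpace K)) = 1 := rfl
      rw [this, map_one]; rfl
    simpa only [hF'0] using key
  · filter_upwards [hνκ] with h hh s _ using hMnn h hh s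
  · exact Eventually.of_forall fun h s _ => hderiv h s

/-- **`τ(X) ∫ τ(h) x_h dν = ∫ τ(h) τ(h⁻¹Xh) x_h dν`** (hypotheses as above). [folklore] -/
theorem archDerivE_integral_apply_toArch (hτ : τ.IsStronglyContinuous) (hτb : ∀ g, ‖(τ g : E →L[ℂ] E)‖ ≤ 1)
    (ν : Measure (GL (Fin n) (mixedSpace K))) [IsFiniteMeasure ν] {κ : Set (GL (Fin n) (mixedSpace K))} (hκ : IsCompact κ)
    (hνκ : ∀ᵐ h ∂ν, h ∈ κ) {x : GL (Fin n) (mixedSpace K) → E} (hx : IsGardingContComb hcpt τ x)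
    (X : Matrix (Fin n) (Fin n) (mixedSpace K)) :
    archDerivE hcpt τ X (∫ h, τ (toArch hcpt h) (x h) ∂ν) =
      ∫ h, τ (toArch hcpt h) (archDerivE hcpt τ (((h⁻¹ : GL (Fin n) (mixedSpace K)) : Matrix (Fin n) (Fin n) (mixedSpace K)) * X *
        (h : Matrix (Fin n) (Fin n) (mixedSpace K))) (x h)) ∂ν := by
  have key := hasDerivAt_integral_apply_expGL_mul hτ hτb ν hκ hνκ hx X
  -- `τ(e^{sX}) ∫ τ(h) x_h = ∫ τ(e^{sX} h) x_h`
  have hint : Integrable (fun h => τ (toArch hcpt h) (x h)) ν := by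
    have hc : Continuous fun h => τ (toArch hcpt h) (x h) := by
      simpa only [one_mul] using continuous_apply_toArch_mul_comb hτ hx 1
    obtain ⟨M₀, hM₀⟩ := exists_forall_mem_norm_le hc hκ
    refine Integrable.mono' (integrable_const (max M₀ 0)) hc.aestronglyMeasurable ?_
    filter_upwards [hνκ] with h hh
    exact (hM₀ h hh).trans (le_max_left _ _)
  have hfun : (fun s : ℝ => τ (toArch hcpt (expGL (s • X))) (∫ h, τ (toArch hcpt h) (x h) ∂ν)) =
      fun s => ∫ h, τ (toArch hcpt (expGL (s • X) * h)) (x h) ∂ν := by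
    funext s
    rw [← ContinuousLinearMap.integral_comp_comm _ hint]
    refine integral_congr_ae (Eventually.of_forall fun h => ?_)
    change (τ (toArch hcpt (expGL (s • X))) * τ (toArch hcpt h)) (x h) = _
    rw [← map_mul]
    rfl
  unfold archDerivE
  rw [hfun]
  exact key.deriv

/-- **Word version**: `τ(w) ∫ τ(h) x_h dν = ∫ τ(h) τ(Ad(h⁻¹) w) x_h dν`. [folklore] -/
theorem archWordDerivE_integral_apply_toArch (hτ : τ.IsStronglyContinuous) (hτb : ∀ g, ‖(τ g : E →L[ℂ] E)‖ ≤ 1)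
    (ν : Measure (GL (Fin n) (mixedSpace K))) [IsFiniteMeasure ν] {κ : Set (GL (Fin n) (mixedSpace K))} (hκ : IsCompact κ)
    (hνκ : ∀ᵐ h ∂ν, h ∈ κ) :
    ∀ (w : List (Matrix (Fin n) (Fin n) (mixedSpace K))) {x : GL (Fin n) (mixedSpace K) → E} (_ : IsGardingContComb hcpt τ x),
      archWordDerivE hcpt τ w (∫ h, τ (toArch hcpt h) (x h) ∂ν) =
        ∫ h, τ (toArch hcpt h) (archWordDerivE hcpt τ (w.map fun X => ((h⁻¹ : GL (Fin n) (mixedSpace K)) : Matrix (Fin n) (Fin n) (mixedSpace K)) * X *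
          (h : Matrix (Fin n) (Fin n) (mixedSpace K))) (x h)) ∂ν
  | [], x, hx => by simp
  | X :: w, x, hx => by
    have ih := archWordDerivE_integral_apply_toArch hτ hτb ν hκ hνκ w hx
    -- the inner family is again a finite continuous combination
    have hx' : IsGardingContComb hcpt τ (fun h => archWordDerivE hcpt τ (w.map fun X => ((h⁻¹ : GL (Fin n) (mixedSpace K)) :
        Matrix (Fin n) (Fin n) (mixedSpace K)) * X * (h : Matrix (Fin n) (Fin n) (mixedSpace K))) (x h)) := by
      have h := hx.archWordDerivE_map hτ (w.map fun X => fun h : GL (Fin n) (mixedSpace K) =>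
        ((h⁻¹ : GL (Fin n) (mixedSpace K)) : Matrix (Fin n) (Fin n) (mixedSpace K)) * X * (h : Matrix (Fin n) (Fin n) (mixedSpace K)))
        (fun Xf hXf => by
          obtain ⟨Y, -, rfl⟩ := List.mem_map.1 hXf
          exact continuous_conj_inv Y)
      simpa only [List.map_map, Function.comp_def] using h
    rw [archWordDerivE_cons, ih, archDerivE_integral_apply_toArch hτ hτb ν hκ hνκ hx' X]
    simp only [List.map_cons, archWordDerivE_cons]

end Smoothing

/-! ### 3. Exchange with Sobolev-bounded functionals -/

section Exchange

variable {E : Type*} [NormedAddCommGroup E] [InnerProductSpace ℂ E] [CompleteSpace E]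
  {τ : ContRepresentation ℂ (AutomorphyDatum.gl n K hcpt).arch.carrier E}

/-- **Exchange of a Sobolev-bounded functional with the smoothing integral.** Let `τ` act by operators of
norm `≤ 1` on a Hilbert space, `ν` a finite measure carried by a compact set, `x` a finite continuous
combination of Gårding vectors, and `ℓ` a linear functional on the Gårding space bounded by finitely
many `U(𝔤)`-seminorms. If `S = ∫ τ(h) x_h dν(h)` lies in the Gårding space, then
`ℓ(S) = ∫ ℓ(τ(h) x_h) dν(h)` (Riesz form `ℓ = Σ_w ⟪y_w, τ(w) ·⟫`, the word formula and
`τ(h) τ(Ad(h⁻¹) w) = τ(w) τ(h)`). This is how integrated representations `π(f) = ∫ f(p) π(p) dp` of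
`P` act on `θ`-covariant distribution vectors in Jacquet–Shalika (1981), §3.
[cite: JacquetShalikaAJM1981, §3, (3.1)–(3.3)] -/
theorem apply_integral_apply_toArch_eq_integral (hτ : τ.IsStronglyContinuous) (hτb : ∀ g, ‖(τ g : E →L[ℂ] E)‖ ≤ 1)
    (ν : Measure (GL (Fin n) (mixedSpace K))) [IsFiniteMeasure ν] {κ : Set (GL (Fin n) (mixedSpace K))} (hκ : IsCompact κ)
    (hνκ : ∀ᵐ h ∂ν, h ∈ κ) {x : GL (Fin n) (mixedSpace K) → E} (hx : IsGardingContComb hcpt τ x)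
    {ℓ : archGardingSpace hcpt τ →ₗ[ℂ] ℂ}
    (hℓ : ∃ (C : ℝ) (𝒮 : Finset (List (Matrix (Fin n) (Fin n) (mixedSpace K)))), 0 ≤ C ∧
      ∀ v : archGardingSpace hcpt τ, ‖ℓ v‖ ≤ C * ∑ w ∈ 𝒮, ‖archWordDerivE hcpt τ w v‖)
    (hS : ∫ h, τ (toArch hcpt h) (x h) ∂ν ∈ archGardingSpace hcpt τ) :
    ℓ ⟨∫ h, τ (toArch hcpt h) (x h) ∂ν, hS⟩ =
      ∫ h, ℓ ⟨τ (toArch hcpt h) (x h), apply_mem_archGardingSpace hτ _ (hx.mem h)⟩ ∂ν := by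
  obtain ⟨C, 𝒮, -, hbound⟩ := hℓ
  obtain ⟨y, hy⟩ := exists_eq_sum_inner_archWordDerivE hτ hbound
  -- each word term
  have hterm : ∀ w ∈ 𝒮, ⟪y w, archWordDerivE hcpt τ w (∫ h, τ (toArch hcpt h) (x h) ∂ν)⟫_ℂ =
      ∫ h, ⟪y w, archWordDerivE hcpt τ w (τ (toArch hcpt h) (x h))⟫_ℂ ∂ν := by
    intro w _
    rw [archWordDerivE_integral_apply_toArch hτ hτb ν hκ hνκ w hx]
    -- integrability of the integrand (continuous, bounded on the carrier)
    have hx' : IsGardingContComb hcpt τ (fun h => archWordDerivE hcpt τ (w.map fun X => ((h⁻¹ : GL (Fin n) (mixedSpace K)) :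
        Matrix (Fin n) (Fin n) (mixedSpace K)) * X * (h : Matrix (Fin n) (Fin n) (mixedSpace K))) (x h)) := by
      have h := hx.archWordDerivE_map hτ (w.map fun X => fun h : GL (Fin n) (mixedSpace K) =>
        ((h⁻¹ : GL (Fin n) (mixedSpace K)) : Matrix (Fin n) (Fin n) (mixedSpace K)) * X * (h : Matrix (Fin n) (Fin n) (mixedSpace K)))
        (fun Xf hXf => by
          obtain ⟨Y, -, rfl⟩ := List.mem_map.1 hXf
          exact continuous_conj_inv Y)
      simpa only [List.map_map, Function.comp_def] using h
    have hc : Continuous fun h => τ (toArch hcpt h) (archWordDerivE hcpt τ (w.map fun X => ((h⁻¹ : GL (Fin n) (mixedSpace K)) :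
        Matrix (Fin n) (Fin n) (mixedSpace K)) * X * (h : Matrix (Fin n) (Fin n) (mixedSpace K))) (x h)) := by
      simpa only [one_mul] using continuous_apply_toArch_mul_comb hτ hx' 1
    have hint : Integrable (fun h => τ (toArch hcpt h) (archWordDerivE hcpt τ (w.map fun X => ((h⁻¹ : GL (Fin n) (mixedSpace K)) :
        Matrix (Fin n) (Fin n) (mixedSpace K)) * X * (h : Matrix (Fin n) (Fin n) (mixedSpace K))) (x h))) ν := by
      obtain ⟨M₀, hM₀⟩ := exists_forall_mem_norm_le hc hκ
      refine Integrable.mono' (integrable_const (max M₀ 0)) hc.aestronglyMeasurable ?_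
      filter_upwards [hνκ] with h hh
      exact (hM₀ h hh).trans (le_max_left _ _)
    rw [← integral_inner hint]
    refine integral_congr_ae (Eventually.of_forall fun h => ?_)
    dsimp only
    rw [archWordDerivE_apply_toArch hτ h (hx.mem h) w]
  -- assemble
  rw [hy]
  have hrhs : (fun h => ℓ ⟨τ (toArch hcpt h) (x h), apply_mem_archGardingSpace hτ _ (hx.mem h)⟩) =
      fun h => ∑ w ∈ 𝒮, ⟪y w, archWordDerivE hcpt τ w (τ (toArch hcpt h) (x h))⟫_ℂ := by
    funext h; rw [hy]
  rw [hrhs, integral_finsetSum _ fun w hw => ?_]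
  · exact Finset.sum_congr rfl hterm
  · -- integrability of each scalar term
    have hx' : IsGardingContComb hcpt τ (fun h => archWordDerivE hcpt τ (w.map fun X => ((h⁻¹ : GL (Fin n) (mixedSpace K)) :
        Matrix (Fin n) (Fin n) (mixedSpace K)) * X * (h : Matrix (Fin n) (Fin n) (mixedSpace K))) (x h)) := by
      have h := hx.archWordDerivE_map hτ (w.map fun X => fun h : GL (Fin n) (mixedSpace K) =>
        ((h⁻¹ : GL (Fin n) (mixedSpace K)) : Matrix (Fin n) (Fin n) (mixedSpace K)) * X * (h : Matrix (Fin n) (Fin n) (mixedSpace K)))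
        (fun Xf hXf => by
          obtain ⟨Y, -, rfl⟩ := List.mem_map.1 hXf
          exact continuous_conj_inv Y)
      simpa only [List.map_map, Function.comp_def] using h
    have hc : Continuous fun h => τ (toArch hcpt h) (archWordDerivE hcpt τ (w.map fun X => ((h⁻¹ : GL (Fin n) (mixedSpace K)) :
        Matrix (Fin n) (Fin n) (mixedSpace K)) * X * (h : Matrix (Fin n) (Fin n) (mixedSpace K))) (x h)) := by
      simpa only [one_mul] using continuous_apply_toArch_mul_comb hτ hx' 1
    have hc' : Continuous fun h => ⟪y w, archWordDerivE hcpt τ w (τ (toArch hcpt h) (x h))⟫_ℂ := by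
      have heq : (fun h => ⟪y w, archWordDerivE hcpt τ w (τ (toArch hcpt h) (x h))⟫_ℂ) = fun h =>
          ⟪y w, τ (toArch hcpt h) (archWordDerivE hcpt τ (w.map fun X => ((h⁻¹ : GL (Fin n) (mixedSpace K)) :
            Matrix (Fin n) (Fin n) (mixedSpace K)) * X * (h : Matrix (Fin n) (Fin n) (mixedSpace K))) (x h))⟫_ℂ := by
        funext h; rw [archWordDerivE_apply_toArch hτ h (hx.mem h) w]
      rw [heq]
      exact continuous_const.inner hc
    obtain ⟨M₀, hM₀⟩ := hκ.exists_bound_of_continuousOn hc'.continuousOn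
    refine Integrable.mono' (integrable_const (max M₀ 0)) hc'.aestronglyMeasurable ?_
    filter_upwards [hνκ] with h hh
    exact (hM₀ h hh).trans (le_max_left _ _)

end Exchange

end Literature.NumberTheory.Automorphic
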